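import Literature.NumberTheory.EllipticCurves.Kobayashi2003.EtaColemanInterpolation
import Literature.NumberTheory.EllipticCurves.Kato2004.ExpStarCorestrictionRootSystem
import HarnessLib

/-!
# Kobayashi 2003, §8.5–§8.7 (Cor. 8.20, Prop. 8.25 with (8.29), Prop. 8.26): the interpolation law of the EVEN
# Coleman map AS A MAP, in ONE COHERENT FRAME — the Gauss sum taken at a root system `μ` TIED TO the `exp*`-datum
# (supersedes the frame-mismatched `ColPlusInterpolation` / `exists_colPlusInterpolation` of p834027; [A′])

Topic `NumberTheory/EllipticCurves`, sub-directory `Kobayashi2003` (namespace = path).  Cell `bsd-cm`, seat `bsd-cm-k-ty1`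
g40 (literature-prover), item (T1) [A′] of director-bsd (993)(a)(iii) after critic idea-crit-15 NOTE #66 (memo
`pub/ideators/idea-crit-15/K8-FRAME-DEFECT.md` 927a9924ca280a05), pen bsd-cm-plan D1211 CONCUR, host bsd-eis L129 (e)
criterion (iv) FRAME COHERENCE.  Declarations: one `def` with a body (`padicGaussSumAt`, the Gauss sum at a NAMED root),
three predicates (`IsCoherentPadicEmbeddings`, `ColPlusLawCoherent`, `ColPlusInterpolationCoherent`), ONE named PUBLISHED fact
(`exists_colPlusInterpolationCoherent`, `def … : Prop`, D-0014: nothing asserted, no `_holds`; +1 declared debt, meant to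
REPLACE the quarantined `exists_colPlusInterpolation`), two `rfl`/unfolding lemmas (`padicGaussSumAt_def`, `colPlusLawCoherent_iff`).
No `sorry`, no instance, no notation, no `set_option`; the token `IsCyclotomicExtension.zeta` occurs in NO declaration.
The sibling p834027 is NOT edited (superseded, director (993)(a)(iii)(T1)).

## What was wrong with [A] (p834027) and what is different here

In `ColPlusInterpolation` the Gauss sum `padicGaussSum p m ιp ψ′ = Σ_b ψ′(b)·ιp(zeta m)^b` is taken at Lean's per-level
`IsCyclotomicExtension.zeta m ℚ (CyclotomicField m ℚ)` (one `Classical.choice` per level type), while the `exp*`-value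
`Λ (n+1) ∅ (…)` it multiplies lives in the frame that `Kato2004.DefinedExpStarBody` (DEF) pins through the tree's tower
embedding at that level (a second, unrelated opaque choice per level); the relative offset of the two frames varies from
level to level without control, so the law with ONE scalar `λ` asserted a compatibility of opaque choices that print does
not give (critic NOTE #66 §2; pen D1211; this seat's check cm STATUS 2026-08-31T22:42:57Z).  Print (Kobayashi §8.4 p. 16,
Prop. 8.25/(8.29) p. 24, Prop. 8.26 p. 25) uses ONE norm-coherent root system `(ζ_{p^{n+1}})_n` for BOTH the points
`c_n = ε[+]F_ss(ζ_{p^{n+1}} − 1)` from which the Coleman maps are built AND the Gauss sum «`τ(ψ) = Σ_{σ∈G_{n}} ψ(σ) ζ^σ_{p^{n+1}}`».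
HERE, accordingly:
* the root system is NAMED: `μ : ∀ n, CyclotomicField (cycLevel p (n+1) ∅) ℚ`, tied to the value datum `Λ` by the
  hypothesis `Kato2004.IsTraceCoherentRootSystem W p Λ μ` (primitive + «`exp*` commutes with corestriction/trace along
  the level maps `j_n`, `j_n(μ_n) = μ_{n+1}^p`» — sibling file `Kato2004/ExpStarCorestrictionRootSystem.lean`; its
  existence for the (DEF)-pinned `Λ` is the separate named fact [C-align] there), and the Gauss sum is
  `padicGaussSumAt p m ιp (μ n) ψ′ = Σ_b ψ′(b)·ιp(μ_n)^b`;
* the `p`-adic embeddings `ιp` are COHERENT ON `μ` along `ℚ(ζ_p)` ((COH_μ): `ιp(μ_n)^{p^n} = ιp(μ_0)`,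
  `IsCoherentPadicEmbeddings`) — the tame anchor that makes the sign `√p* ↔ τ(η)` level-independent; the wild
  re-alignments `ιp_n ↦ ιp_n ∘ σ_a`, `a ≡ 1 (p)`, change nothing (they multiply `τ·Σ` by `η(a) = 1`);
* A UNIT `u ∈ Λˣ` multiplies `P.colPlus z` in the law (form (β′), critic NOTE #70 (E1), pen D1214 (P9), host E-g43-9):
  the quantifier order is [A]'s (`∀ I FB, ∃ P, ∀ (exp*-datum) ∀ μ ∀ ιp, ∃ λ u, ∀ z n ψ`), and the trace-coherent root
  systems form a `ℤ_pˣ`-TORSOR (`μ ↦ μ^v` keeps primitivity and the trace clause, which does not see `μ`, and multiplies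
  `τ(ψ)` by `ψ̄(v) = η(v)·ψ₀(γ)^{−e(v)}` — not a scalar in `ψ`); `u = (1+T)^{−e(v)}` absorbs it (in print, changing the
  root system `ζ ↦ ζ^v` conjugates Kobayashi's points `c_n` and multiplies the Coleman map by that group-like unit;
  `u = 1` for the formal-group system of §8.4 p. 16).  WITHOUT `u` the closed Prop would be false (two `ψ` of one level);
  with it it is print read through the flag.  Downstream cost nil: (W1) `IwasawaAlgebra.exists_pow_smul_eq_of_values_proportional`
  takes units and the 2c-T1 stub absorbs them into `P₁`/`z₁` exactly as F1 absorbed hC's `w`.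
Everything else — the quantifier order, the `HasSum` currency at `ψ(γ) − 1`, `(−1)^{n/2+1}`, `ω_n⁻ = cyclotomicOmegaMinus`, the `W`-currency
character `ψ′^{p^n−1} = ψ⁻¹η`, the read-off `padicCharSum` of `Λ_{n+1,∅}(res (I.proj n z))`, the frame of
`thm62_63_73_etaColemanPoitouTate` — is [A]'s text VERBATIM.  Form (β′) is WEAKER than print (one free scalar `λ ≠ 0`;
the `η`-twist transport `ω_V ↔ ω_W` over `ℚ_p(√p*)` stays kernel duty [C]), never stronger: for a trace-coherent `μ`
(= a norm-coherent system of `ℚ̄` seen through the frames of `Λ`, up to the torsor and up to level automorphisms fixing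
every `exp*`-value — module docstring of the sibling) and a coherent `ιp` (re-aligned wildly to a tower-coherent one, which
the law does not see) the statement IS Prop. 8.25/(8.29)/8.26 with Cor. 8.20 read in Kobayashi's single `p`-adic frame, times
the unit.  LEVEL `n = 0` INSTANCE: `ψ = η`, `ζ = 1`, `ω_0⁻ = 1`, `ψ^{p^0−1} = 1`:
`(u·P.colPlus z)(0) = −λ · τ_μ(η) · Σ_{b ∈ (ℤ/p)ˣ} (ιp ∘ σ_b)(Λ_{1,∅}(res z_0))` (Prop. 8.26 at `m = n = 0`).

WHAT IS NOT HERE: no value of `λ`; no (VAL), no «`a = b`»; no `Col⁻` twin (TODO(general form): the `−` law with `ω_n⁺`,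
`n` odd); no new field on `EtaColemanPoitouTateData`; no edit of p834027; nothing about BSD; no summit statement touched.
CHEAPEST FALSIFIER (typing, registered): the consumer F1′ must instantiate `IsTraceCoherentRootSystem` and
`DefinedExpStarBody` with THE SAME `Λ` and obtain `μ` from [C-align] — any mismatch of binder types shows at that junction.

References: [Kobayashi2003] §8.4 (p. 16), §8.5 (p. 20), Cor. 8.20 (p. 21), (8.24) (p. 20), Prop. 8.25 and (8.29) (p. 24),
Prop. 8.26 and the proof of Thm. 6.3 (p. 25), Thm. 6.2–6.3 (p. 11), Thm. 7.3 i) and Cor. 7.2 (p. 13); [Kato2004Asterisque]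
§9.4 (p. 188), §12.2 (p. 220), Thm. 12.4–12.5 (p. 221); [BlochKato1990] §3; [Rubin2000] App. B §2.
-/

noncomputable section

open scoped Classical TensorProduct NumberField

open CongruenceSubgroup Polynomial WeierstrassCurve Field IsDedekindDomain
  Literature.NumberTheory.EllipticCurves Literature.NumberTheory.EllipticCurves.ModularForms
  Literature.NumberTheory.GaloisRepresentations Literature.NumberTheory.EllipticCurves.Kato2004
  Literature.NumberTheory.EllipticCurves.Kato2004.EulerSystemValues ZpExtension

namespace Literature.NumberTheory.EllipticCurves.Kobayashi2003

/-! ## §1 The Gauss sum at a NAMED root (a definition) and the coherence of `p`-adic embeddings on a root system -/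

section PadicReading

variable (p : ℕ) [Fact p.Prime]

/-- Kobayashi's GAUSS SUM `τ(θ) = Σ_{b ∈ (ℤ/m)ˣ} θ(b) · ιp(ζ)^b` of a `ℂ_p`-valued Dirichlet character mod `m`, taken at a
NAMED root of unity `ζ ∈ ℚ(ζ_m)` read through the `p`-adic embedding `ιp` (print: «Here `τ(ψ)` is the Gauss sum
`Σ_{σ∈G_{m}} ψ(σ) ζ^σ_{p^{m+1}}`» with THE coherent `ζ_{p^{m+1}}` of §8.4).  A definition (the sibling's `padicGaussSum` is
the instance `ζ =` Lean's per-level `zeta`, definitionally; no bridge lemma is stated — [A] is quarantined).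
[cite: Kobayashi2003, Prop. 8.26 (p. 25) and §8.4 (p. 16)] -/
def padicGaussSumAt (m : ℕ) [NeZero m] (ιp : CyclotomicField m ℚ →+* ℂ_[p]) (ζ : CyclotomicField m ℚ)
    (θ : DirichletCharacter ℂ_[p] m) : ℂ_[p] :=
  ∑ b : (ZMod m)ˣ, θ (b : ZMod m) * ιp ζ ^ (b : ZMod m).val

/-- Unfolding `padicGaussSumAt`. [cite: Kobayashi2003, Prop. 8.26 (p. 25)] -/
theorem padicGaussSumAt_def (m : ℕ) [NeZero m] (ιp : CyclotomicField m ℚ →+* ℂ_[p]) (ζ : CyclotomicField m ℚ)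
    (θ : DirichletCharacter ℂ_[p] m) :
    padicGaussSumAt p m ιp ζ θ = ∑ b : (ZMod m)ˣ, θ (b : ZMod m) * ιp ζ ^ (b : ZMod m).val :=
  rfl

/-- **(COH_μ) `IsCoherentPadicEmbeddings p μ ιp`**: the `p`-adic embeddings `ιp_{m(n+1,∅)} : ℚ(ζ_{p^{n+1}}) → ℂ_p` are
COHERENT ON THE ROOT SYSTEM `μ` along `ℚ(ζ_p)`: `ιp(μ_n)^{p^n} = ιp(μ_0)` for every `n` (the images of the `p`-th roots
`μ_n^{p^n}` agree).  This is the tame anchor of the law below (it fixes the reading of `√p* ∈ ℚ(ζ_p)`, hence the sign of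
`τ(η)`, across levels); a tower-coherent family (`ιp(μ_{n+1})^p = ιp(μ_n)`) satisfies it, and the law is insensitive to
the wild re-alignments `ιp_n ↦ ιp_n ∘ σ_a`, `a ≡ 1 (mod p)`, that separate the two notions.  It is the condition that the
`p`-adic readings `ιp(μ_n)` reproduce the NORM-COHERENCE of print's root system («`(ζ_{p^{n+1}})_n`, `ζ_{p^{n+2}}^p = ζ_{p^{n+1}}`»,
§8.4) on `ℚ(ζ_p)`; [A]'s (COH) with `zeta ↦ μ`.  A predicate; nothing asserted. [cite: Kobayashi2003, §8.4 (p. 16)] -/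
def IsCoherentPadicEmbeddings (μ : ∀ n : ℕ, CyclotomicField (cycLevel p (n + 1) ∅) ℚ)
    (ιp : (m : ℕ) → (CyclotomicField m ℚ →+* ℂ_[p])) : Prop :=
  ∀ n : ℕ, ιp (cycLevel p (n + 1) ∅) (μ n) ^ (p ^ n) = ιp (cycLevel p (0 + 1) ∅) (μ 0)

end PadicReading

/-! ## §2 The law in one coherent frame (predicates: the law for `(P, Λ, μ, ιp, λ, u)`; the interpolation property of `P`) -/

section Law

variable (p : ℕ) [Fact p.Prime] {K₀ : Type} [Field K₀] [NumberField K₀] [(galRange (K := ℚ) K₀).Normal]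
  {η : absoluteGaloisGroup ℚ →* ℤˣ} {V : WeierstrassCurve ℚ} [V.IsElliptic] {N : ℕ} {f : CuspForm (Gamma0 N) 2}
  {ϖ : ℚ} {κ : ZpExtension ℚ p} {γ : absoluteGaloisGroup ℚ}
  {W : WeierstrassCurve ℚ} [W.IsElliptic] [ContinuousSMul ℤ_[p] (W.tateModule p)]
  [Module.Free ℤ_[p] (W.tateModule p)] [Module.Finite ℤ_[p] (W.tateModule p)]
  {I : Kato2004.IwasawaH1Data W p κ γ} {FB : W.FineSelmerDualData κ γ}

/-- **`ColPlusLawCoherent p hκ hp P Λ μ ιp lam u` — Kobayashi's interpolation law of the even Coleman map `P.colPlus` AS A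
MAP (Cor. 8.20 ∘ Prop. 8.25 ∘ (8.29) ∘ Prop. 8.26), in the frame `(Λ, μ, ιp)` with the scalar `lam` and the unit `u ∈ Λˣ`:**
for every `z : I.H`, every EVEN `n` and every Dirichlet character `ψ` mod `p^{n+1}` of order `2pⁿ` (`ψ = ηχ`), with `ζ = ψ(1+p)`:
`(u · P.colPlus z)(ζ − 1) = lam · (−1)^{n/2+1} · τ_μ(ψ) / ω_n⁻(ζ − 1) · Σ_{b ∈ (ℤ/p^{n+1})ˣ} ψ(b)^{p^n − 1} · (ιp ∘ σ_b)(Λ_{n+1,∅}(res z_n))`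
— left side as a `HasSum`, `τ_μ(ψ) = padicGaussSumAt … (μ n) ψ′` THE GAUSS SUM AT THE NAMED ROOT `μ_n`,
`ω_n⁻ = cyclotomicOmegaMinus`, `res z_n` the restriction of `I.proj n z ∈ H¹(ℚ_n, T_pW)` to `ℚ(μ_{p^{n+1}})`
(`cyclotomicLevelsRat_level_succ_le_layerSubgroup`, `p` odd), `ψ′^{p^n−1} = ψ⁻¹·η` the `W`-currency character
(flag `Kob03-eta-twist-currency` of the sibling).  [A]'s law VERBATIM but for `zeta ↦ μ n` and `P.colPlus z ↦ u · P.colPlus z`.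
A predicate; nothing asserted.
[cite: Kobayashi2003, Cor. 8.20 (p. 21), Prop. 8.25 and (8.29) (p. 24), Prop. 8.26 (p. 25), §8.4 (p. 16)]
[cite: Kato2004Asterisque, §9.4 (p. 188), §12.2 (p. 220)] -/
def ColPlusLawCoherent (hκ : κ.IsCyclotomic) (hp : p ≠ 2)
    (P : EtaColemanPoitouTateData p K₀ η V f ϖ κ γ W I FB)
    (Λ : ∀ (k : ℕ) (r : Finset (HeightOneSpectrum (𝓞 ℚ))),
      H1 (tateRep W p) (cycSubgroup p k r) →ₗ[ℤ_[p]] ℚ_[p] ⊗[ℚ] CyclotomicField (cycLevel p k r) ℚ)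
    (μ : ∀ n : ℕ, CyclotomicField (cycLevel p (n + 1) ∅) ℚ)
    (ιp : (m : ℕ) → (CyclotomicField m ℚ →+* ℂ_[p])) (lam : ℂ_[p]) (u : (IwasawaAlgebra p)ˣ) : Prop :=
  ∀ (z : I.H) (n : ℕ), Even n →
    ∀ ψ : DirichletCharacter ℂ_[p] (p ^ (n + 1)), orderOf ψ = 2 * p ^ n →
      HasSum
        (fun k : ℕ ↦ ((algebraMap ℚ_[p] ℂ_[p]).comp (algebraMap ℤ_[p] ℚ_[p]))
            (PowerSeries.coeff k ((u : IwasawaAlgebra p) * P.colPlus z)) *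
          (ψ (cyclotomicGenerator p : ZMod (p ^ (n + 1))) - 1) ^ k)
        (lam *
          ((-1 : ℂ_[p]) ^ (n / 2 + 1) *
            padicGaussSumAt p (cycLevel p (n + 1) ∅) (ιp (cycLevel p (n + 1) ∅)) (μ n)
              (DirichletCharacter.changeLevel
                (show p ^ (n + 1) ∣ cycLevel p (n + 1) ∅ from dvd_mul_right _ _) ψ) /
            (cyclotomicOmegaMinus p n).eval₂ (algebraMap ℤ ℂ_[p])
              (ψ (cyclotomicGenerator p : ZMod (p ^ (n + 1))) - 1)) *
          padicCharSum p (cycLevel p (n + 1) ∅) (ιp (cycLevel p (n + 1) ∅))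
            ((DirichletCharacter.changeLevel
                (show p ^ (n + 1) ∣ cycLevel p (n + 1) ∅ from dvd_mul_right _ _) ψ) ^ (p ^ n - 1))
            (Λ (n + 1) ∅
              (resLe (tateRep W p).toTopRep (hκ.cyclotomicLevelsRat_level_succ_le_layerSubgroup hp ∅ n) 1
                (I.proj n z))))

/-- **`ColPlusInterpolationCoherent p hκ hp P` — the §8.7 interpolation property of the pinned package `P` IN EVERY COHERENT
FRAME** ([A]'s `ColPlusInterpolation` with the frame repaired): for every exp*-datum `(f_W, d, ι, κK, Λ)` of `W` with
`Kato2004.DefinedExpStarBody W p f_W d ι κK Λ`, every root system `μ` TRACE-COHERENT with `Λ`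
(`Kato2004.IsTraceCoherentRootSystem W p Λ μ`: primitive `p^{n+1}`-th roots, `exp* ∘ cor = (1 ⊗ Tr_{j_n}) ∘ exp*` along
`j_n(μ_n) = μ_{n+1}^p`) and every family of `p`-adic embeddings coherent on `μ` along `ℚ(ζ_p)` ((COH_μ),
`IsCoherentPadicEmbeddings p μ ιp`), there are ONE scalar `λ ∈ ℂ_p`, `λ ≠ 0`, and ONE unit `u ∈ Λˣ` with the law
`ColPlusLawCoherent p hκ hp P Λ μ ιp λ u` at every `z : I.H`, every even `n`, every `ψ` of order `2pⁿ`.  `λ, u` are bound AFTER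
the datum, the root system and the embeddings and BEFORE `z, n, ψ` ([A]'s placement; `u` absorbs the `ℤ_pˣ`-torsor of root
systems, module docstring).  A predicate; nothing asserted; existence for SOME package is the named fact below.
[cite: Kobayashi2003, §8.4 (p. 16), Cor. 8.20 (p. 21), Prop. 8.25 and (8.29) (p. 24), Prop. 8.26 and proof of Thm. 6.3 (p. 25)]
[cite: Kato2004Asterisque, §9.4 (p. 188), §12.2 (p. 220)] -/
def ColPlusInterpolationCoherent (hκ : κ.IsCyclotomic) (hp : p ≠ 2)
    (P : EtaColemanPoitouTateData p K₀ η V f ϖ κ γ W I FB) : Prop :=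
  ∀ {N' : ℕ} [NeZero N'] (f' : CuspForm (Gamma0 N') 2) (d : _) (ι : (m : ℕ) → (CyclotomicField m ℚ →+* ℂ))
    (κK : ℝ)
    (Λ : ∀ (k : ℕ) (r : Finset (HeightOneSpectrum (𝓞 ℚ))),
      H1 (tateRep W p) (cycSubgroup p k r) →ₗ[ℤ_[p]] ℚ_[p] ⊗[ℚ] CyclotomicField (cycLevel p k r) ℚ),
    DefinedExpStarBody W p f' d ι κK Λ →
  ∀ (μ : ∀ n : ℕ, CyclotomicField (cycLevel p (n + 1) ∅) ℚ), IsTraceCoherentRootSystem W p Λ μ →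
  ∀ (ιp : (m : ℕ) → (CyclotomicField m ℚ →+* ℂ_[p])), IsCoherentPadicEmbeddings p μ ιp →
  ∃ (lam : ℂ_[p]) (u : (IwasawaAlgebra p)ˣ), lam ≠ 0 ∧ ColPlusLawCoherent p hκ hp P Λ μ ιp lam u

end Law

/-! ## §3 The named fact [A′]: for every coherent frame, a package whose `Col⁺` satisfies the §8.7 law in that frame -/

/-- **Kobayashi 2003, §8.4–§8.7 (Cor. 8.20, Prop. 8.25 with (8.29), Prop. 8.26) on top of Thm. 6.2 (6.13)/(6.15) + Thm. 6.3 +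
Thm. 7.3 i) + Cor. 7.2 at the quadratic `η`, on pinned objects, IN ONE COHERENT FRAME — existence form (β′).**  For the frame
of `thm62_63_73_etaColemanPoitouTate` VERBATIM (`p` odd, `K₀ = ℚ(μ_p)`, `η` trivial on `Gal(ℚ̄/K₀)` and `≠ 1`, `V/ℚ`
globally minimal with good reduction at `p` and `a_p(V) = 0`, newform `f`, period ratio `ϖ`, cyclotomic `κ` with generator
`γ ∈ Gal(ℚ̄/K₀)` matching the cyclotomic variable, a model `W` of the twist `V^{(p*)}` with `C • W.quadraticTwist p* = V`),
every pinned `I : Kato2004.IwasawaH1Data W p κ γ` and `FB : W.FineSelmerDualData κ γ`: there is a package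
`P : EtaColemanPoitouTateData p K₀ η V f ϖ κ γ W I FB` whose `colPlus` satisfies `ColPlusInterpolationCoherent p hκ hp P` (§2:
in every coherent frame `(Λ, μ, ιp)` — exp*-datum with `Kato2004.DefinedExpStarBody`, root system with
`Kato2004.IsTraceCoherentRootSystem`, embeddings with `IsCoherentPadicEmbeddings` — ONE scalar `λ ≠ 0` and ONE unit `u ∈ Λˣ`
give the law `ColPlusLawCoherent` at every `z : I.H`, even `n`, `ψ` of order `2pⁿ`).  Printed content: the package exists
(Thm. 6.2/6.3/7.3 i)/Cor. 7.2 = sibling fact) with its Coleman maps BUILT ON the coherent root system of §8.4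
(`c_n = ε[+]F_ss(ζ_{p^{n+1}} − 1)`), and `Col⁺`'s values on every class are given by Prop. 8.25/(8.29)/8.26 with `τ(ψ)` AT THE
SAME ROOTS (module docstring: why the unit, why (β′) is weaker than print and never stronger).  The `ℤ_p`-structure facts of
`T_pW` are supplied by the tree theorems (as in `Kato2004.IsAdmissibleZetaClass`).  Named fact (D-0014); nothing asserted; no
`_holds` (Honda theory, §8).
Non-vacuity: frame = `thm62_63_73_etaColemanPoitouTate`; exp*-antecedent = `Kato2004.exists_eulerSystem_definedExpStar_values`;
root-system antecedent = `Kato2004.exists_traceCoherentRootSystem_of_definedExpStarBody` ([C-align]); coherent `ιp` exist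
(choose level by level and re-align on `ℚ(ζ_p)`).  SUPERSEDES `exists_colPlusInterpolation` (p834027, frame-mismatched
as typed, QUARANTINED by director-bsd (993)(a)(i)).
[cite: Kobayashi2003, §8.4 (p. 16), Cor. 8.20 (p. 21), Prop. 8.25 and (8.29) (p. 24), Prop. 8.26 and proof of Thm. 6.3 (p. 25), Thm. 6.2–6.3 (p. 11), Thm. 7.3 i) and Cor. 7.2 (p. 13)]
[cite: Kato2004Asterisque, §9.4 (p. 188), §12.2 (p. 220), Thm. 12.4 (p. 221)] [cite: BlochKato1990, §3] -/
def exists_colPlusInterpolationCoherent : Prop :=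
  ∀ (p : ℕ) [Fact p.Prime] (K₀ : Type) [Field K₀] [NumberField K₀] [IsCyclotomicExtension {p} ℚ K₀]
    [(galRange (K := ℚ) K₀).Normal] (η : absoluteGaloisGroup ℚ →* ℤˣ),
    (∀ σ ∈ galRange (K := ℚ) K₀, η σ = 1) → η ≠ 1 →
  ∀ (V : WeierstrassCurve ℚ) [V.IsElliptic] [V.IsGloballyMinimal] {N : ℕ} [NeZero N]
    {f : CuspForm (Gamma0 N) 2} (hp : p ≠ 2),
    V.HasGoodReductionAtPrime p → V.frobeniusTrace p = 0 → IsNewformOf V f →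
  ∀ (ϖ : ℚ), (if Even (p / 2) then (ϖ : ℝ) * V.realPeriodRat = plusPeriod f
      else (ϖ : ℝ) * V.imaginaryPeriodRat = minusPeriod f) →
  ∀ (κ : ZpExtension ℚ p) (γ : absoluteGaloisGroup ℚ) (hκ : κ.IsCyclotomic),
    κ.IsTopGenerator γ → γ ∈ galRange (K := ℚ) K₀ → IsCyclotomicVariable p γ →
  ∀ (W : WeierstrassCurve ℚ) [W.IsElliptic] [ContinuousSMul ℤ_[p] (W.tateModule p)]
    (C : VariableChange ℚ), C • W.quadraticTwist ((-1) ^ (p / 2) * p) = V →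
  ∀ (I : Kato2004.IwasawaH1Data W p κ γ) (FB : W.FineSelmerDualData κ γ),
    ∃ P : EtaColemanPoitouTateData p K₀ η V f ϖ κ γ W I FB,
      letI : Module.Free ℤ_[p] (W.tateModule p) := W.module_free_tateModule_holds p
      letI : Module.Finite ℤ_[p] (W.tateModule p) := W.module_finite_tateModule_holds p
      ColPlusInterpolationCoherent p hκ hp P

/-- Unfolding the law (for consumers that destructure the `HasSum`). [cite: Kobayashi2003, Prop. 8.25 (p. 24)] -/
theorem colPlusLawCoherent_iff {p : ℕ} [Fact p.Prime] {K₀ : Type} [Field K₀] [NumberField K₀]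
    [(galRange (K := ℚ) K₀).Normal] {η : absoluteGaloisGroup ℚ →* ℤˣ} {V : WeierstrassCurve ℚ} [V.IsElliptic]
    {N : ℕ} {f : CuspForm (Gamma0 N) 2} {ϖ : ℚ} {κ : ZpExtension ℚ p} {γ : absoluteGaloisGroup ℚ}
    {W : WeierstrassCurve ℚ} [W.IsElliptic] [ContinuousSMul ℤ_[p] (W.tateModule p)]
    [Module.Free ℤ_[p] (W.tateModule p)] [Module.Finite ℤ_[p] (W.tateModule p)]
    {I : Kato2004.IwasawaH1Data W p κ γ} {FB : W.FineSelmerDualData κ γ}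
    (hκ : κ.IsCyclotomic) (hp : p ≠ 2) (P : EtaColemanPoitouTateData p K₀ η V f ϖ κ γ W I FB)
    (Λ : ∀ (k : ℕ) (r : Finset (HeightOneSpectrum (𝓞 ℚ))),
      H1 (tateRep W p) (cycSubgroup p k r) →ₗ[ℤ_[p]] ℚ_[p] ⊗[ℚ] CyclotomicField (cycLevel p k r) ℚ)
    (μ : ∀ n : ℕ, CyclotomicField (cycLevel p (n + 1) ∅) ℚ)
    (ιp : (m : ℕ) → (CyclotomicField m ℚ →+* ℂ_[p])) (lam : ℂ_[p]) (u : (IwasawaAlgebra p)ˣ) :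
    ColPlusLawCoherent p hκ hp P Λ μ ιp lam u ↔
      ∀ (z : I.H) (n : ℕ), Even n →
        ∀ ψ : DirichletCharacter ℂ_[p] (p ^ (n + 1)), orderOf ψ = 2 * p ^ n →
          HasSum
            (fun k : ℕ ↦ ((algebraMap ℚ_[p] ℂ_[p]).comp (algebraMap ℤ_[p] ℚ_[p]))
                (PowerSeries.coeff k ((u : IwasawaAlgebra p) * P.colPlus z)) *
              (ψ (cyclotomicGenerator p : ZMod (p ^ (n + 1))) - 1) ^ k)
            (lam *
              ((-1 : ℂ_[p]) ^ (n / 2 + 1) *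
                padicGaussSumAt p (cycLevel p (n + 1) ∅) (ιp (cycLevel p (n + 1) ∅)) (μ n)
                  (DirichletCharacter.changeLevel
                    (show p ^ (n + 1) ∣ cycLevel p (n + 1) ∅ from dvd_mul_right _ _) ψ) /
                (cyclotomicOmegaMinus p n).eval₂ (algebraMap ℤ ℂ_[p])
                  (ψ (cyclotomicGenerator p : ZMod (p ^ (n + 1))) - 1)) *
              padicCharSum p (cycLevel p (n + 1) ∅) (ιp (cycLevel p (n + 1) ∅))
                ((DirichletCharacter.changeLevel
                    (show p ^ (n + 1) ∣ cycLevel p (n + 1) ∅ from dvd_mul_right _ _) ψ) ^ (p ^ n - 1))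
                (Λ (n + 1) ∅
                  (resLe (tateRep W p).toTopRep (hκ.cyclotomicLevelsRat_level_succ_le_layerSubgroup hp ∅ n) 1
                    (I.proj n z)))) :=
  Iff.rfl

end Literature.NumberTheory.EllipticCurves.Kobayashi2003

end
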